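import Summits.CriticalPhenomena.PercolationContinuityZ3.Theorems.FK.UniquenessOfEqualConnectivity
import Summits.CriticalPhenomena.PercolationContinuityZ3.Theorems.FK.InfiniteVolumeDLROneEdgeIff
import Summits.CriticalPhenomena.PercolationContinuityZ3.Theorems.FK.DLRSandwich
import HarnessLib

/-!
# FK-continuity cell, FO-10a: the edge density of EVERY DLR random-cluster measure is `p/q + p(1 − q⁻¹)·τ(x,y)`,
# and the extremal DLR states are characterised by their nearest-neighbour connectivities
# (Grimmett 2006, Prop. (4.37)(a) eq. (4.38); Prop. (4.6) / Thm. (4.34) eq. (4.36) read on `R_{p,q}`)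

Registered R81 (cell INBOX l.5913, 2026-08-23); registry row FO-10a-g337; label CRT-C (coordinator fk-4 g175).
Cell `fk-continuity` (bschramm), row FO-10a (domain-Markov + comparison layer over FO-06); support file for the
FK-continuity transplant (`--supports stmt-CriticalPhenomena-4575`); builds on p205010 (kernel theorem, internal audit
signed; external expert review pending). Pure proofs; no definitions, no named facts, no sorries; general `d`.

Notation: `R_{p,q} ∋ P` = `IsDLRRandomCluster d p q P` (Grimmett Def. (4.29)), `τ_P(x,y) = P.real (openConn x y)`,
`φ^b_{p,q} = rcLimit d b p q`, `J_e = {ω | e ∈ ω}`, `K_e = (· \ {e}) ⁻¹' openConn x y` for the lattice edge `e = ⟨x,y⟩`.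

* **`IsDLRRandomCluster.real_edgeOpen_eq_div_add_mul_real_openConn (hP : IsDLRRandomCluster d p q P) (hp : p ∈ Icc 0 1)
  (hq : 0 < q) (hxy : (zdGraph d).Adj x y) : P(J_e) = p/q + p(1 − q⁻¹)·τ_P(x,y)`** — for EVERY DLR random-cluster
  measure and EVERY `q > 0` (for `q < 1` the coefficient is negative): Grimmett's Prop. (4.37)(a) (row FO-10b-g407's
  `IsDLRRandomCluster.real_edgeOpen_inter_preimage_eq`, the one-edge conditional probabilities (4.38)) with `H₀ = Ω` and
  `H₀ = {x ↮ y}`, and the algebra of `UniquenessOfEqualConnectivity.lean`.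
* **`IsDLRRandomCluster.eq_rcLimit_false_of_forall_real_openConn_le`** — a lattice-carried `P ∈ R_{p,q}` (`0 < p < 1`, `q ≥ 1`)
  whose nearest-neighbour connectivities do not exceed the free ones, `τ_P(x,y) ≤ τ⁰(x,y)` for all `x ~ y`, IS `φ⁰_{p,q}`;
  `IsDLRRandomCluster.eq_rcLimit_true_of_forall_le_real_openConn` — the wired twin. (Prop. (4.6) for the class, FO-06a-7
  `FKGibbs.eq_rcLimit_false_of_forall_real_setOf_mem_le`, its edge-density hypothesis discharged through the affine identity;
  `R_{p,q} ⊆` sandwich class by row FO-10a-g335d's `IsDLRRandomCluster.fkGibbs`.)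
* `IsDLRRandomCluster.eq_rcLimit_false_iff_forall_real_openConn_eq` / `…_true_iff_…` — the extremal DLR states are
  EXACTLY the DLR states with the extremal nearest-neighbour two-point function; `IsDLRRandomCluster.real_openConn_mem_Icc`
  (`τ⁰ ≤ τ_P ≤ τ¹` at every pair, for the record).

Honest framing: UNCONDITIONAL infinite-volume structure (every `d`); it decides nothing about `q ∈ (1,2)` at `p_c(q)`;
NOT a binder discharge, NOT `_r4`; `_r3` « 2 / 0 ☑ », n_open = 2 unchanged.

## References

* G. Grimmett, *The Random-Cluster Model*, Springer 2006 (`book:grimmett2006-random-cluster-model`): Prop. (4.37)(a)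
  eq. (4.38) [PDF p. 83]; Prop. (4.6) [PDF p. 70]; Thm. (4.34) eq. (4.36) [PDF p. 81]; proof of Prop. (4.85), eq. (4.88)
  [PDF p. 95]. [Grimmett2006]
-/

noncomputable section

open MeasureTheory Set Filter
open scoped Topology ENNReal

namespace Summit.CriticalPhenomena.PercolationContinuityZ3.Theorems.FK

open Literature.Probability.Percolation Literature.Probability.LatticeModels

variable {d : ℕ} {p q : ℝ} {P : Measure (BondConfig (Site d))}

/-! ### The affine identity for every DLR random-cluster measure -/

/-- **`P(J_e) = p/q + p(1 − q⁻¹)·P(x ↔ y)` for every DLR random-cluster measure `P ∈ R_{p,q}`** (`0 ≤ p ≤ 1`, `q > 0`,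
every lattice edge `e = ⟨x,y⟩`, every `d`): from the one-edge conditional probabilities (4.38).
[cite: Grimmett2006, Prop. (4.37)(a) eq. (4.38); proof of Prop. (4.85), p. 95] -/
theorem IsDLRRandomCluster.real_edgeOpen_eq_div_add_mul_real_openConn (hP : IsDLRRandomCluster d p q P)
    (hp : p ∈ Set.Icc (0 : ℝ) 1) (hq : 0 < q) {x y : Site d} (hxy : (zdGraph d).Adj x y) :
    P.real {ω | s(x, y) ∈ ω} = p / q + p * (1 - q⁻¹) * P.real (openConn x y) := by
  haveI := hP.isProbabilityMeasure
  have hOm : MeasurableSet (openConn x y : Set (BondConfig (Site d))) := measurableSet_openConn_holds x y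
  -- (4.38) with `H₀ = Ω` and with `H₀ = {x ↮ y}`
  have h1 := hP.real_edgeOpen_inter_preimage_eq hp hq hxy MeasurableSet.univ
  have h2 := hP.real_edgeOpen_inter_preimage_eq hp hq hxy hOm.compl
  simp only [Set.preimage_univ, Set.inter_univ, Set.univ_inter, Set.compl_inter_self, Set.preimage_empty,
    measureReal_empty, mul_zero, zero_add, Set.inter_self] at h1 h2
  set K : Set (BondConfig (Site d)) := (fun η : BondConfig (Site d) => η \ {s(x, y)}) ⁻¹' openConn x y
    with hK
  have hKc : (fun η : BondConfig (Site d) => η \ {s(x, y)}) ⁻¹' (openConn x y)ᶜ = Kᶜ := by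
    rw [Set.preimage_compl]
  rw [hKc] at h1 h2
  have hKm : MeasurableSet K := hOm.preimage (measurable_closeEdges _)
  have hJm : MeasurableSet {ω : BondConfig (Site d) | s(x, y) ∈ ω} :=
    measurableSet_of_isLocalEvent_holds (isLocalEvent_setOf_mem _)
  -- `P(x ↮ y) = P(K_eᶜ) - P(J_e ∩ K_eᶜ)`
  have h3 : P.real (openConn x y)ᶜ = P.real Kᶜ - P.real ({ω | s(x, y) ∈ ω} ∩ Kᶜ) := by
    rw [compl_openConn_eq_inter_of_ne hxy.ne, ← hK]
    have : {ω : BondConfig (Site d) | s(x, y) ∉ ω} ∩ Kᶜ = Kᶜ \ ({ω | s(x, y) ∈ ω} ∩ Kᶜ) := by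
      ext ω; simp only [mem_inter_iff, mem_setOf_eq, Set.mem_sdiff, mem_compl_iff]; tauto
    rw [this, measureReal_sdiff Set.inter_subset_right (hJm.inter hKm.compl)]
  have hKc1 : P.real Kᶜ = 1 - P.real K := probReal_compl_eq_one_sub hKm
  have hOc : P.real (openConn x y)ᶜ = 1 - P.real (openConn x y) := probReal_compl_eq_one_sub hOm
  have halg := sub_div_eq_mul_one_sub_div hp hq
  linear_combination h1 + p * hKc1 - p * (1 - q⁻¹) * hOc + p * (1 - q⁻¹) * h3 - p * (1 - q⁻¹) * h2
    - P.real Kᶜ * halg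

/-! ### The extremal DLR states are characterised by their nearest-neighbour connectivities -/

/-- For the record: **`τ⁰(x,y) ≤ τ_P(x,y) ≤ τ¹(x,y)`** for every lattice-carried `P ∈ R_{p,q}` (`0 < p < 1`, `q ≥ 1`) and
all sites `x, y` (`{x ↔ y}` is increasing; `R_{p,q} ⊆` sandwich class). [cite: Grimmett2006, Thm. (4.34)(b) eq. (4.35)] -/
theorem IsDLRRandomCluster.real_openConn_mem_Icc (hP : IsDLRRandomCluster d p q P) (hE : ∀ᵐ ω ∂P, ω ⊆ (zdGraph d).edgeSet)
    (hp : p ∈ Set.Ioo (0 : ℝ) 1) (hq : 1 ≤ q) (x y : Site d) :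
    P.real (openConn x y) ∈
      Set.Icc ((rcLimit d false p q).real (openConn x y)) ((rcLimit d true p q).real (openConn x y)) :=
  (hP.fkGibbs hp hq hE).real_openConn_mem_Icc (Set.Ioo_subset_Icc_self hp) hq x y

/-- **A DLR random-cluster measure whose nearest-neighbour connectivities do not exceed the free ones IS the free
measure**: `P ∈ R_{p,q}` lattice-carried (`0 < p < 1`, `q ≥ 1`), `τ_P(x,y) ≤ φ⁰_{p,q}(x ↔ y)` for every lattice edge `⟨x,y⟩`
⇒ `P = φ⁰_{p,q}`. (Then `P(e open) ≤ h⁰(e)` by the affine identity, and Prop. (4.6) for the class.)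
[cite: Grimmett2006, Prop. (4.6) with Thm. (4.34) eq. (4.35)–(4.36) and Prop. (4.37)(a)] -/
theorem IsDLRRandomCluster.eq_rcLimit_false_of_forall_real_openConn_le (hP : IsDLRRandomCluster d p q P)
    (hE : ∀ᵐ ω ∂P, ω ⊆ (zdGraph d).edgeSet) (hp : p ∈ Set.Ioo (0 : ℝ) 1) (hq : 1 ≤ q)
    (h : ∀ ⦃x y : Site d⦄, (zdGraph d).Adj x y → P.real (openConn x y) ≤ (rcLimit d false p q).real (openConn x y)) :
    P = rcLimit d false p q := by
  have hp' : p ∈ Set.Icc (0 : ℝ) 1 := Set.Ioo_subset_Icc_self hp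
  have hq0 : 0 < q := one_pos.trans_le hq
  have hc : 0 ≤ p * (1 - q⁻¹) := mul_nonneg hp'.1 (sub_nonneg.2 (inv_le_one_of_one_le₀ hq))
  refine (hP.fkGibbs hp hq hE).eq_rcLimit_false_of_forall_real_setOf_mem_le hp' hq fun e he => ?_
  induction e using Sym2.ind with
  | h x y =>
    have hxy : (zdGraph d).Adj x y := (SimpleGraph.mem_edgeSet _).1 he
    rw [hP.real_edgeOpen_eq_div_add_mul_real_openConn hp' hq0 hxy,
      freeEdgeDensity_eq_div_add_mul_real_openConn hp' hq hxy]
    gcongr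
    exact h hxy

/-- **The wired twin**: `P ∈ R_{p,q}` lattice-carried (`0 < p < 1`, `q ≥ 1`) with `φ¹_{p,q}(x ↔ y) ≤ τ_P(x,y)` for every
lattice edge ⇒ `P = φ¹_{p,q}`. [cite: Grimmett2006, Prop. (4.6) with Thm. (4.34) eq. (4.35)–(4.36) and Prop. (4.37)(a)] -/
theorem IsDLRRandomCluster.eq_rcLimit_true_of_forall_le_real_openConn (hP : IsDLRRandomCluster d p q P)
    (hE : ∀ᵐ ω ∂P, ω ⊆ (zdGraph d).edgeSet) (hp : p ∈ Set.Ioo (0 : ℝ) 1) (hq : 1 ≤ q) (hd : 0 < d)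
    (h : ∀ ⦃x y : Site d⦄, (zdGraph d).Adj x y → (rcLimit d true p q).real (openConn x y) ≤ P.real (openConn x y)) :
    P = rcLimit d true p q := by
  have hp' : p ∈ Set.Icc (0 : ℝ) 1 := Set.Ioo_subset_Icc_self hp
  have hq0 : 0 < q := one_pos.trans_le hq
  have hc : 0 ≤ p * (1 - q⁻¹) := mul_nonneg hp'.1 (sub_nonneg.2 (inv_le_one_of_one_le₀ hq))
  refine (hP.fkGibbs hp hq hE).eq_rcLimit_true_of_forall_le_real_setOf_mem hd hp' hq fun e he => ?_
  induction e using Sym2.ind with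
  | h x y =>
    have hxy : (zdGraph d).Adj x y := (SimpleGraph.mem_edgeSet _).1 he
    rw [hP.real_edgeOpen_eq_div_add_mul_real_openConn hp' hq0 hxy,
      wiredEdgeDensity_eq_div_add_mul_real_openConn hp' hq hxy]
    gcongr
    exact h hxy

/-- **`P = φ⁰_{p,q}` iff `P` has the free nearest-neighbour two-point function** (`P ∈ R_{p,q}` lattice-carried,
`0 < p < 1`, `q ≥ 1`). [cite: Grimmett2006, Prop. (4.6) with Thm. (4.34) eq. (4.36) and Prop. (4.37)(a)] -/
theorem IsDLRRandomCluster.eq_rcLimit_false_iff_forall_real_openConn_eq (hP : IsDLRRandomCluster d p q P)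
    (hE : ∀ᵐ ω ∂P, ω ⊆ (zdGraph d).edgeSet) (hp : p ∈ Set.Ioo (0 : ℝ) 1) (hq : 1 ≤ q) :
    P = rcLimit d false p q ↔
      ∀ ⦃x y : Site d⦄, (zdGraph d).Adj x y → P.real (openConn x y) = (rcLimit d false p q).real (openConn x y) :=
  ⟨fun h _ _ _ => by rw [h], fun h => hP.eq_rcLimit_false_of_forall_real_openConn_le hE hp hq fun _ _ hxy => (h hxy).le⟩

/-- **`P = φ¹_{p,q}` iff `P` has the wired nearest-neighbour two-point function** (`P ∈ R_{p,q}` lattice-carried,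
`0 < p < 1`, `q ≥ 1`, `d ≥ 1`). [cite: Grimmett2006, Prop. (4.6) with Thm. (4.34) eq. (4.36) and Prop. (4.37)(a)] -/
theorem IsDLRRandomCluster.eq_rcLimit_true_iff_forall_real_openConn_eq (hP : IsDLRRandomCluster d p q P)
    (hE : ∀ᵐ ω ∂P, ω ⊆ (zdGraph d).edgeSet) (hp : p ∈ Set.Ioo (0 : ℝ) 1) (hq : 1 ≤ q) (hd : 0 < d) :
    P = rcLimit d true p q ↔
      ∀ ⦃x y : Site d⦄, (zdGraph d).Adj x y → P.real (openConn x y) = (rcLimit d true p q).real (openConn x y) :=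
  ⟨fun h _ _ _ => by rw [h], fun h => hP.eq_rcLimit_true_of_forall_le_real_openConn hE hp hq hd fun _ _ hxy => (h hxy).ge⟩

end Summit.CriticalPhenomena.PercolationContinuityZ3.Theorems.FK

end
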